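import Literature.MathematicalPhysics.QuantumFieldTheory.Balaban1983to89.B4Eq19LatticeHarmonicDecay
import Literature.MathematicalPhysics.QuantumFieldTheory.Balaban1983to89.LatticeFieldCalculus
import Literature.MathematicalPhysics.QuantumFieldTheory.Balaban1983to89.B10Eq27TorusAxialLog
import HarnessLib

/-!
# Route R of crux K1 «MinimiserStabilityRegPr» (stmt-QuantumFields-19200) — THE FLAT LINEAR CORE OF THE INTERIOR MEAN-VALUE INPUT:
# `sup² ≤ C_d·ℓ^{−d}·(mass on an ENLARGED box)` FOR LATTICE-HARMONIC FUNCTIONS AND FOR CURL-FREE, DIVERGENCE-FREE BOND FIELDS,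
# ON `ℤ^d` AND ON EVERY TORUS `T^{(j)}` OF `Setup` (brick 1; cell `ym3-torus`, width seat `ym-ust-19200-w1` g6; OWNER ACK 22 (a);
# `--supports stmt-QuantumFields-19200 --as helper`, count-neutral)

YM₃ on T³ is a RUNG of the ladder (R3), not the Clay problem; nothing here claims the stub, the crux or the gap.

WHY.  Route R's nonlinear passage (CARD-19200-V3-g11 §6 (S3)∕(S3′)) and the `ℓ²` reading of the `Q^{(k)}`-defect source
(`Prop7FibreQDefect.sum_normSq_linAvgIterM_sub_one_le_of_localReg`, p609586) DISPLAY an interior regularity input of mean-value type,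
`hreg : ρ_c² ≤ C_reg·(L^k)⁻³·Σ_{b ⊂ B^k(c₋)∪B^k(c₊)} ‖Y_b‖²` (local sup of the representative against its local mass).  As displayed — the SAME
two blocks on both sides — the shape is not dischargeable uniformly in `k` even for harmonic data (lattice-harmonic polynomials of degree `m` on a
block have `sup²∕(ℓ⁻³·mass) ≍ m`); the dischargeable shape has an ENLARGED box on the right.  This file proves that shape at the FLAT LINEAR level
(the part that is pure lattice analysis), by the discrete Campanato road already in the tree ([Giaquinta1984] Ch. III §1–2 on `ℤ^d`:
`B4Eq19LatticeCaccioppoli`, `B4Eq19LatticeMixedSobolev`, `B4Eq19LatticeHarmonicDecay` — which carry the `L² → L^∞` bound only for the GRADIENT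
of a harmonic function, `sq_fdiff_le_of_harmonic`), and carries it to bond fields and to the torus.

WHAT IS PROVED (sorry-free, no definition).
* §1 (`ℤ^d`, scalar) ★ `sq_le_of_harmonic` — for `κ ≥ 0`, `ℓ ≥ 1`, `ρ₀ ≥ 0` and `h` `κ`-harmonic (`lop κ h = 0`) on `Q_{ρ₀+ℓ+d(ℓ+2)}(z)`:
  `h(x)² ≤ 2^d(1+56d)^d·(ℓ+1)^{−d}·Σ_{Q_{ρ₀+ℓ+d(ℓ+2)}(z)} h²` for every `x ∈ Q_{ρ₀}(z)` (mixed Sobolev on the cube `x + [0,ℓ]^d` + iterated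
  Caccioppoli; the `h`-twin of `sq_fdiff_le_of_harmonic`).
* §2 (`ℤ^d`, bond fields `X : ℤ^d → Fin d → ℝ`) ★ `lop_comp_eq_dvg_add_fdiff_dvg` — THE SOURCE TERMS, both in divergence form:
  `lop 0 (X · μ) x = dvg (fun y ν => C_X(y;ν,μ)) x + fdiff μ (dvg X) x` with the plaquette variable
  `C_X(y;ν,μ) = X(y,ν) + X(y+e_ν,μ) − X(y+e_μ,ν) − X(y,μ)` written INLINE (antisymmetric in `ν, μ`, zero on the diagonal), i.e.
  `−ΔX_μ = ∂*(curl column μ) + ∂_μ(∂*X)` pointwise — the flat lattice Weitzenböck identity [Balaban1984PropagatorsI] (1.21), of which the tree had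
  the global `L²` form only (`Prop7FlatHodgeCoercivity.sum_grad_sq_eq_curl_add_diverg`); `lop_comp_eq_zero_of_curlFree_divFree` (each
  component of a curl-free, divergence-free field is harmonic); ★ `sq_le_of_curlFree_divFree` — `C_X = 0` and `dvg X = 0` on `Q_{R+1}(z)`,
  `R = ρ₀+ℓ+d(ℓ+2)` ⇒ `X(x,μ)² ≤ 2^d(1+56d)^d(ℓ+1)^{−d}·Σ_{Q_R(z)} X(·,μ)²` for `x ∈ Q_{ρ₀}(z)`.
* §3 (torus `T^{(j)}` of `Setup`, any `P`, `j`; letters `LatticeFieldCalculus.laplace∕curl∕diverg 1`; the periodic pullback along the torus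
  dictionary `B10Eq27TorusAxialLog.transl x₀ : ℤ^d → Site P j`) `lop_pullback_eq_laplace`, `dvg_pullback_eq_diverg`, `plaq_pullback_eq`;
  ★ `laplace_comp_eq_sum_plaq_add_diverg` — the torus Weitzenböck identity with sources,
  `laplace 1 (y ↦ X⟨y,μ⟩) x = Σ_ν (C_X(x−e_ν;ν,μ) − C_X(x;ν,μ)) + (diverg 1 X (x+e_μ) − diverg 1 X x)`;
  `plaq_eq_curl`∕`plaq_eq_neg_curl`∕`plaq_self` (the inline plaquette variable IS `± curl 1 X` off the diagonal);
  ★★ `sq_pullback_le_of_harmonic` and ★★ `sq_le_of_curl_eq_zero_of_diverg_eq_zero` — if `curl 1 X = 0` on the plaquettes and `diverg 1 X = 0` at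
  the sites based in `transl x₀ '' Q_{R+1}(0)`, then for every `z ∈ Q_{ρ₀}(0)` and `μ`:
  `X⟨transl x₀ z, μ⟩² ≤ 2^d(1+56d)^d(ℓ+1)^{−d}·Σ_{z′ ∈ Q_R(0)} X⟨transl x₀ z′, μ⟩²` — stated through the pullback, so NO period∕injectivity
  hypothesis is needed (when `2R+1 ≤ sitesPerDir j` the right side is the plain sum over the image, `B10Eq71TorusLocal.transl_injOn`).
READING FOR THE CONSUMER (d = 3, `ℓ = L^k ≥ 3`, `x₀ = embIter k c.src`): `B^k(c₋) ∪ B^k(c₊) ⊂ transl x₀ '' Q_{(3ℓ−1)/2}(0)`, and with the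
Caccioppoli scale `ℓ` the hypothesis box is `Q_{(11ℓ+13)/2}(0) ⊂ Q_{8ℓ}(0)`: `N(c) := transl (embIter k c.src) '' Q_{8L^k}(0)` (inside the `17³`
`k`-blocks around `c₋`), constant `8·169³·(L^k+1)⁻³` per real component.

HONEST SCOPE.  [folklore] lattice analysis ([Giaquinta1984] Ch. III), flat and LINEAR; curl and divergence enter §2∕§3 only as an identity in
divergence form `−ΔX_μ = ∂*g_μ` — the `L^∞` estimate for the SOURCED equation at the scaling the nonlinear passage needs (`sup|w| ≤ C·ℓ·‖g‖_∞` for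
the box Dirichlet corrector) is NOT here (brick 2); the centre charges of the pinned representative and every nonlinear∕covariant statement are
untouched (★p1's fork).  Nothing of [Balaban1985Variational] ∕ [Balaban1984PropagatorsII] is asserted.

References: M. Giaquinta, *Multiple integrals in the calculus of variations and nonlinear elliptic systems*, Princeton UP 1983 [Giaquinta1984]
(Ch. III §1 Thm 1.2 p.70, §2 (2.5) p.78); T. Bałaban, CMP 95 (1984) 17–40 [Balaban1984PropagatorsI] ((1.21) p.21); CMP 96 (1984) 223–250
[Balaban1984PropagatorsII] ((1.9) p.226); CMP 102 (1985) 277–309 [Balaban1985Variational] (Prop. 7 p.299).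
-/

set_option autoImplicit false

noncomputable section

open scoped BigOperators
open Finset

namespace Summit.QuantumFields.YangMills.Theorems.Prop7FlatInteriorMeanValue

open Literature.MathematicalPhysics.QuantumFieldTheory.Balaban1983to89
open B4Eq19LatticeOperators B4Eq19LatticeCaccioppoli B4Eq19LatticeMixedSobolev B4Eq19LatticeHarmonicDecay
open LatticeFieldCalculus (laplace curl diverg)
open B10Eq27TorusAxialLog (transl transl_add_e transl_sub_e transl_zero)

/-! ## §1 The `L² → L^∞` mean-value bound for `κ`-harmonic functions on `ℤ^d` -/

section Zd

variable {d : ℕ}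

/-- ★ **MEAN-VALUE (SUP) BOUND FOR `κ`-HARMONIC FUNCTIONS ON `ℤ^d`.**  For `κ ≥ 0`, `ℓ ≥ 1`, `ρ₀ ≥ 0`, `x ∈ Q_{ρ₀}(z)` and `h` `κ`-harmonic on
`Q_{ρ₀+ℓ+d(ℓ+2)}(z)`: `h(x)² ≤ 2^d (1+56d)^d (ℓ+1)^{−d} · Σ_{y ∈ Q_{ρ₀+ℓ+d(ℓ+2)}(z)} h(y)²` (mixed Sobolev embedding of `h` on the cube
`x + [0,ℓ]^d`, then the iterated Caccioppoli inequality `Σ(∂_S h)² ≤ (14d∕ℓ²)^{|S|} Σ h²`; `(ℓ+1)²∕ℓ² ≤ 4` and `Σ_S (56d)^{|S|} = (1+56d)^d`).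
The `h`-twin of `B4Eq19LatticeHarmonicDecay.sq_fdiff_le_of_harmonic`. [folklore] [cite: Giaquinta1984, Ch. III §2 (2.5) p.78] -/
theorem sq_le_of_harmonic {κ : ℝ} (hκ : 0 ≤ κ) {z : Zd d} {ℓ : ℕ} (hℓ : 1 ≤ ℓ) {ρ₀ : ℤ} (hρ₀ : 0 ≤ ρ₀) (h : Zd d → ℝ)
    (hh : ∀ y ∈ box z (ρ₀ + ℓ + d * ((ℓ : ℤ) + 2)), lop κ h y = 0) {x : Zd d} (hx : x ∈ box z ρ₀) :
    h x ^ 2 ≤ (2 : ℝ) ^ d * (1 + 56 * d) ^ d / ((ℓ : ℝ) + 1) ^ d * ∑ y ∈ box z (ρ₀ + ℓ + d * ((ℓ : ℤ) + 2)), h y ^ 2 := by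
  classical
  set E := ∑ y ∈ box z (ρ₀ + ℓ + d * ((ℓ : ℤ) + 2)), h y ^ 2 with hEdef
  have hE0 : 0 ≤ E := Finset.sum_nonneg fun _ _ => sq_nonneg _
  have hl : (0 : ℝ) < (ℓ : ℝ) + 1 := by positivity
  have hl1 : (1 : ℝ) ≤ ℓ := by exact_mod_cast hℓ
  -- Sobolev on the full set of directions
  have hS := sq_le_sum_powerset_cube (Finset.univ : Finset (Fin d)) h x ℓ
  rw [Finset.card_univ, Fintype.card_fin] at hS
  -- each subset term
  have hterm : ∀ S ∈ (Finset.univ : Finset (Fin d)).powerset,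
      (((ℓ : ℝ) + 1) ^ (2 * S.card) / ((ℓ : ℝ) + 1) ^ d) * ∑ v ∈ cube Finset.univ ℓ, fdS S h (x + v) ^ 2 ≤
        ((56 * d : ℝ) ^ S.card / ((ℓ : ℝ) + 1) ^ d) * E := by
    intro S _
    have hSd : S.card ≤ d := by simpa using Finset.card_le_univ S
    -- cube → box
    have h1 : ∑ v ∈ cube Finset.univ ℓ, fdS S h (x + v) ^ 2 ≤ ∑ y ∈ box z (ρ₀ + ℓ), fdS S h y ^ 2 :=
      sum_cube_le_sum_box (G := fun y => fdS S h y ^ 2) (fun _ => sq_nonneg _) hx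
    -- iterated Caccioppoli
    have hρ1 : (0 : ℤ) ≤ ρ₀ + ℓ := by positivity
    have hSℓ : (S.card : ℤ) * ((ℓ : ℤ) + 2) ≤ d * ((ℓ : ℤ) + 2) :=
      mul_le_mul_of_nonneg_right (by exact_mod_cast hSd) (by positivity)
    have h2 := sum_sq_fdS_le hκ hℓ S h (ρ₀ + ℓ) hρ1 (fun y hy => hh y (box_mono z (by linarith) hy))
    have h3 : ∑ y ∈ box z (ρ₀ + ℓ + S.card * ((ℓ : ℤ) + 2)), h y ^ 2 ≤ E :=
      Finset.sum_le_sum_of_subset_of_nonneg (box_mono z (by linarith)) fun _ _ _ => sq_nonneg _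
    have hc0 : (0 : ℝ) ≤ (14 * d / (ℓ : ℝ) ^ 2) ^ S.card := by positivity
    have h4 : ∑ v ∈ cube Finset.univ ℓ, fdS S h (x + v) ^ 2 ≤ (14 * d / (ℓ : ℝ) ^ 2) ^ S.card * E :=
      h1.trans (h2.trans (mul_le_mul_of_nonneg_left h3 hc0))
    -- constants: `(ℓ+1)^{2s} (14d/ℓ²)^s ≤ (56d)^s`
    have h5 : ((ℓ : ℝ) + 1) ^ (2 * S.card) * (14 * d / (ℓ : ℝ) ^ 2) ^ S.card ≤ (56 * d : ℝ) ^ S.card := by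
      rw [pow_mul, ← mul_pow]
      apply pow_le_pow_left₀ (by positivity)
      have hl2 : ((ℓ : ℝ) + 1) ^ 2 ≤ 4 * (ℓ : ℝ) ^ 2 := by nlinarith
      rw [mul_div_assoc', div_le_iff₀ (by positivity)]
      nlinarith [Nat.cast_nonneg (α := ℝ) d]
    calc (((ℓ : ℝ) + 1) ^ (2 * S.card) / ((ℓ : ℝ) + 1) ^ d) * ∑ v ∈ cube Finset.univ ℓ, fdS S h (x + v) ^ 2
        ≤ (((ℓ : ℝ) + 1) ^ (2 * S.card) / ((ℓ : ℝ) + 1) ^ d) * ((14 * d / (ℓ : ℝ) ^ 2) ^ S.card * E) :=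
          mul_le_mul_of_nonneg_left h4 (by positivity)
      _ = (((ℓ : ℝ) + 1) ^ (2 * S.card) * (14 * d / (ℓ : ℝ) ^ 2) ^ S.card) / ((ℓ : ℝ) + 1) ^ d * E := by ring
      _ ≤ ((56 * d : ℝ) ^ S.card / ((ℓ : ℝ) + 1) ^ d) * E :=
          mul_le_mul_of_nonneg_right (div_le_div_of_nonneg_right h5 (by positivity)) hE0
  -- sum over subsets: `Σ_S (56d)^{|S|} = (1 + 56d)^d`
  have hsum : ∑ S ∈ (Finset.univ : Finset (Fin d)).powerset, ((56 * d : ℝ) ^ S.card / ((ℓ : ℝ) + 1) ^ d) * E =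
      (1 + 56 * d) ^ d / ((ℓ : ℝ) + 1) ^ d * E := by
    rw [← Finset.sum_mul, ← Finset.sum_div]
    congr 2
    have := Finset.sum_pow_mul_eq_add_pow (56 * d : ℝ) 1 (Finset.univ : Finset (Fin d))
    simp only [one_pow, mul_one, Finset.card_univ, Fintype.card_fin] at this
    rw [this, add_comm]
  calc h x ^ 2 ≤ (2 : ℝ) ^ d * ∑ S ∈ (Finset.univ : Finset (Fin d)).powerset,
        (((ℓ : ℝ) + 1) ^ (2 * S.card) / ((ℓ : ℝ) + 1) ^ d) * ∑ v ∈ cube Finset.univ ℓ, fdS S h (x + v) ^ 2 := hS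
    _ ≤ (2 : ℝ) ^ d * ∑ S ∈ (Finset.univ : Finset (Fin d)).powerset, ((56 * d : ℝ) ^ S.card / ((ℓ : ℝ) + 1) ^ d) * E :=
        mul_le_mul_of_nonneg_left (Finset.sum_le_sum hterm) (by positivity)
    _ = (2 : ℝ) ^ d * (1 + 56 * d) ^ d / ((ℓ : ℝ) + 1) ^ d * E := by rw [hsum]; ring

/-! ## §2 Bond fields on `ℤ^d`: the Weitzenböck identity with sources, and the curl-free divergence-free corollary -/

/-- ★ **THE FLAT LATTICE WEITZENBÖCK IDENTITY, POINTWISE, WITH SOURCES IN DIVERGENCE FORM.**  For a bond field `X : ℤ^d → Fin d → ℝ`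
(`X(y, ν)` on the bond `⟨y, y + e_ν⟩`), a direction `μ` and a site `x`:
`(−Δ X_μ)(x) = Σ_ν (C_X(x − e_ν; ν, μ) − C_X(x; ν, μ)) + ((∂*X)(x + e_μ) − (∂*X)(x))`, i.e. `−ΔX_μ = ∂*(ν ↦ C_X(·;ν,μ)) + ∂_μ(∂*X)`,
where `C_X(y; ν, μ) = X(y,ν) + X(y+e_ν,μ) − X(y+e_μ,ν) − X(y,μ)` is the plaquette variable (curl) of `X` on the plaquette `⟨y, ν, μ⟩`
(antisymmetric; zero for `ν = μ`) and `∂* = dvg` the lattice divergence — the component form of `Δ = ∂*∂ + ∂∂*` on 1-forms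
([Balaban1984PropagatorsI] (1.21) «⟨∂A, ∂A⟩ = Σ_μ⟨A_μ, ΔA_μ⟩ − ⟨∂*A, ∂*A⟩», pointwise). [folklore] [cite: Balaban1984PropagatorsI, (1.21) p.21] -/
theorem lop_comp_eq_dvg_add_fdiff_dvg (X : Zd d → Fin d → ℝ) (μ : Fin d) (x : Zd d) :
    lop 0 (fun y => X y μ) x =
      dvg (fun y ν => X y ν + X (y + unitVec ν) μ - X (y + unitVec μ) ν - X y μ) x + fdiff μ (dvg X) x := by
  simp only [lop_apply, dvg_apply, fdiff_apply, zero_mul, add_zero, sub_add_cancel]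
  rw [← Finset.sum_sub_distrib, ← Finset.sum_add_distrib]
  refine Finset.sum_congr rfl fun ν _ => ?_
  rw [sub_add_eq_add_sub x (unitVec ν) (unitVec μ)]
  ring

/-- **Each component of a curl-free, divergence-free bond field is lattice-harmonic.**  If the plaquette variable of `X` vanishes on the plaquettes
based in `Q_{R+1}(z)` and `∂*X` vanishes there, then `(−ΔX_μ)(x) = 0` for every `x ∈ Q_R(z)` and every `μ`. [folklore]
[cite: Balaban1984PropagatorsI, (1.21) p.21] -/
theorem lop_comp_eq_zero_of_curlFree_divFree (X : Zd d → Fin d → ℝ) {z : Zd d} {R : ℤ}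
    (hC : ∀ y ∈ box z (R + 1), ∀ ν μ : Fin d, X y ν + X (y + unitVec ν) μ - X (y + unitVec μ) ν - X y μ = 0)
    (hD : ∀ y ∈ box z (R + 1), dvg X y = 0) (μ : Fin d) {x : Zd d} (hx : x ∈ box z R) :
    lop 0 (fun y => X y μ) x = 0 := by
  have hR : R ≤ R + 1 := by linarith
  rw [lop_comp_eq_dvg_add_fdiff_dvg, dvg_apply, fdiff_apply]
  have h1 : ∀ ν : Fin d, (X (x - unitVec ν) ν + X (x - unitVec ν + unitVec ν) μ - X (x - unitVec ν + unitVec μ) ν - X (x - unitVec ν) μ) -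
      (X x ν + X (x + unitVec ν) μ - X (x + unitVec μ) ν - X x μ) = 0 := fun ν => by
    rw [hC _ (sub_unitVec_mem_box hx ν), hC _ (box_mono z hR hx), sub_zero]
  rw [Finset.sum_eq_zero fun ν _ => h1 ν, hD _ (add_unitVec_mem_box hx μ), hD _ (box_mono z hR hx)]
  ring

/-- ★ **MEAN-VALUE (SUP) BOUND FOR CURL-FREE, DIVERGENCE-FREE BOND FIELDS ON `ℤ^d`.**  `ℓ ≥ 1`, `ρ₀ ≥ 0`, `R := ρ₀ + ℓ + d(ℓ+2)`; if the plaquette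
variable of `X` and `∂*X` vanish on `Q_{R+1}(z)`, then for every `x ∈ Q_{ρ₀}(z)` and every direction `μ`:
`X(x,μ)² ≤ 2^d(1+56d)^d(ℓ+1)^{−d} · Σ_{y ∈ Q_R(z)} X(y,μ)²` (each component is harmonic on `Q_R(z)`; `sq_le_of_harmonic` at `κ = 0`). [folklore]
[cite: Giaquinta1984, Ch. III §2 (2.5) p.78] -/
theorem sq_le_of_curlFree_divFree {z : Zd d} {ℓ : ℕ} (hℓ : 1 ≤ ℓ) {ρ₀ : ℤ} (hρ₀ : 0 ≤ ρ₀) (X : Zd d → Fin d → ℝ)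
    (hC : ∀ y ∈ box z (ρ₀ + ℓ + d * ((ℓ : ℤ) + 2) + 1), ∀ ν μ : Fin d, X y ν + X (y + unitVec ν) μ - X (y + unitVec μ) ν - X y μ = 0)
    (hD : ∀ y ∈ box z (ρ₀ + ℓ + d * ((ℓ : ℤ) + 2) + 1), dvg X y = 0) {x : Zd d} (hx : x ∈ box z ρ₀) (μ : Fin d) :
    X x μ ^ 2 ≤ (2 : ℝ) ^ d * (1 + 56 * d) ^ d / ((ℓ : ℝ) + 1) ^ d * ∑ y ∈ box z (ρ₀ + ℓ + d * ((ℓ : ℤ) + 2)), X y μ ^ 2 :=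
  sq_le_of_harmonic le_rfl hℓ hρ₀ (fun y => X y μ)
    (fun _ hy => lop_comp_eq_zero_of_curlFree_divFree X hC hD μ hy) hx

end Zd

/-! ## §3 The torus `T^{(j)}`: pullback along `transl x₀ : ℤ^d → Site P j`, the Weitzenböck identity with sources, and the mean-value bound -/

section Torus

variable {P : Params} {j : ℕ}

/-- `unitVec` of the `ℤ^d` Campanato road is the `e_μ` of the torus dictionary. [folklore] -/
private theorem unitVec_eq_e (μ : Fin P.d) : (unitVec μ : Zd P.d) = B7Prop1Explicit.e μ := rfl

/-- `transl x₀ (z + e_μ) = (transl x₀ z) + e_μ` with the road's `unitVec`. [folklore] -/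
private theorem transl_add_unitVec (x₀ : Site P j) (z : Zd P.d) (μ : Fin P.d) :
    transl x₀ (z + unitVec μ) = (transl x₀ z).shift μ := by
  rw [unitVec_eq_e, transl_add_e]

/-- `transl x₀ (z − e_μ) = (transl x₀ z) − e_μ` with the road's `unitVec`. [folklore] -/
private theorem transl_sub_unitVec (x₀ : Site P j) (z : Zd P.d) (μ : Fin P.d) :
    transl x₀ (z - unitVec μ) = (transl x₀ z).unshift μ := by
  rw [unitVec_eq_e, transl_sub_e]

/-- `(x − e_ν) + e_ν = x` on the torus, through the dictionary. [folklore] -/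
private theorem shift_unshift' (x : Site P j) (ν : Fin P.d) : (x.unshift ν).shift ν = x := by
  have h1 : transl x (0 - unitVec ν + unitVec ν) = ((transl x 0).unshift ν).shift ν := by
    rw [transl_add_unitVec, transl_sub_unitVec]
  rw [transl_zero] at h1
  rw [← h1, sub_add_cancel, transl_zero]

/-- **The lattice Laplacian pulls back**: for a site function read along `transl x₀`, `lop 0 (z ↦ f(transl x₀ z)) z = (laplace 1 f)(transl x₀ z)`
(`LatticeFieldCalculus.laplace` with lattice factor `1`). [folklore] [cite: Balaban1984PropagatorsI, (1.21) p.21] -/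
theorem lop_pullback_eq_laplace (x₀ : Site P j) (f : Site P j → ℝ) (z : Zd P.d) :
    lop 0 (fun w => f (transl x₀ w)) z = laplace 1 f (transl x₀ z) := by
  simp only [lop_apply, LatticeFieldCalculus.laplace, zero_mul, add_zero, one_pow, one_smul, transl_add_unitVec,
    transl_sub_unitVec]
  refine Finset.sum_congr rfl fun ν _ => ?_
  ring

/-- **The lattice divergence pulls back**: `dvg (z ν ↦ X⟨transl x₀ z, ν⟩) z = (diverg 1 X)(transl x₀ z)`. [folklore]
[cite: Balaban1984PropagatorsI, (1.21) p.21] -/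
theorem dvg_pullback_eq_diverg (x₀ : Site P j) (X : PBond P j → ℝ) (z : Zd P.d) :
    dvg (fun w ν => X ⟨transl x₀ w, ν⟩) z = diverg 1 X (transl x₀ z) := by
  simp only [dvg_apply, LatticeFieldCalculus.diverg, one_smul, transl_sub_unitVec]

/-- **The plaquette variable pulls back**: the inline plaquette variable of the pullback at `(z; ν, μ)` is the torus plaquette expression at
`transl x₀ z`. [folklore] [cite: Balaban1984PropagatorsI, (1.2) p.18] -/
theorem plaq_pullback_eq (x₀ : Site P j) (X : PBond P j → ℝ) (z : Zd P.d) (ν μ : Fin P.d) :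
    X ⟨transl x₀ z, ν⟩ + X ⟨transl x₀ (z + unitVec ν), μ⟩ - X ⟨transl x₀ (z + unitVec μ), ν⟩ - X ⟨transl x₀ z, μ⟩ =
      X ⟨transl x₀ z, ν⟩ + X ⟨(transl x₀ z).shift ν, μ⟩ - X ⟨(transl x₀ z).shift μ, ν⟩ - X ⟨transl x₀ z, μ⟩ := by
  rw [transl_add_unitVec, transl_add_unitVec]

/-- The inline plaquette expression `X⟨y,ν⟩ + X⟨y+e_ν,μ⟩ − X⟨y+e_μ,ν⟩ − X⟨y,μ⟩` IS `curl 1 X` on the plaquette `⟨y, ν, μ⟩` when `ν < μ`.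
[cite: Balaban1984PropagatorsI, (1.2) p.18] -/
theorem plaq_eq_curl (X : PBond P j → ℝ) (y : Site P j) {ν μ : Fin P.d} (hνμ : ν < μ) :
    X ⟨y, ν⟩ + X ⟨y.shift ν, μ⟩ - X ⟨y.shift μ, ν⟩ - X ⟨y, μ⟩ = curl 1 X ⟨y, ν, μ, hνμ⟩ := by
  simp only [LatticeFieldCalculus.curl, one_smul]

/-- … and `−curl 1 X` on the plaquette `⟨y, μ, ν⟩` when `μ < ν` (antisymmetry). [cite: Balaban1984PropagatorsI, (1.2) p.18] -/
theorem plaq_eq_neg_curl (X : PBond P j → ℝ) (y : Site P j) {ν μ : Fin P.d} (hμν : μ < ν) :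
    X ⟨y, ν⟩ + X ⟨y.shift ν, μ⟩ - X ⟨y.shift μ, ν⟩ - X ⟨y, μ⟩ = -curl 1 X ⟨y, μ, ν, hμν⟩ := by
  simp only [LatticeFieldCalculus.curl, one_smul]
  ring

/-- … and `0` on the diagonal `ν = μ`. [folklore] -/
theorem plaq_self (X : PBond P j → ℝ) (y : Site P j) (μ : Fin P.d) :
    X ⟨y, μ⟩ + X ⟨y.shift μ, μ⟩ - X ⟨y.shift μ, μ⟩ - X ⟨y, μ⟩ = 0 := by ring

/-- The inline plaquette expression vanishes at `(y; ν, μ)` for ALL `ν, μ` as soon as `curl 1 X` vanishes on every plaquette based at `y`.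
[cite: Balaban1984PropagatorsI, (1.2) p.18] -/
theorem plaq_eq_zero_of_curl_eq_zero (X : PBond P j → ℝ) (y : Site P j)
    (h : ∀ (ν μ : Fin P.d) (hνμ : ν < μ), curl 1 X ⟨y, ν, μ, hνμ⟩ = 0) (ν μ : Fin P.d) :
    X ⟨y, ν⟩ + X ⟨y.shift ν, μ⟩ - X ⟨y.shift μ, ν⟩ - X ⟨y, μ⟩ = 0 := by
  rcases lt_trichotomy ν μ with hlt | rfl | hgt
  · rw [plaq_eq_curl X y hlt, h ν μ hlt]
  · exact plaq_self X y ν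
  · rw [plaq_eq_neg_curl X y hgt, h μ ν hgt, neg_zero]

/-- ★ **THE FLAT LATTICE WEITZENBÖCK IDENTITY ON THE TORUS `T^{(j)}`, POINTWISE, WITH SOURCES** (letters `LatticeFieldCalculus`, lattice factor `1`):
for a real bond field `X`, a direction `μ` and a site `x`,
`(laplace 1 X_μ)(x) = Σ_ν (C_X(x − e_ν; ν, μ) − C_X(x; ν, μ)) + ((diverg 1 X)(x + e_μ) − (diverg 1 X)(x))`,
`C_X(y; ν, μ) = X⟨y,ν⟩ + X⟨y+e_ν,μ⟩ − X⟨y+e_μ,ν⟩ − X⟨y,μ⟩` (`= ± curl 1 X`, `plaq_eq_curl`∕`plaq_eq_neg_curl`) — i.e. `ΔX_μ = ∂*(curl column μ) + ∂_μ ∂*X`,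
both source terms in divergence form ([Balaban1984PropagatorsI] (1.21), component form; proof: pull back along `transl x` and use §2).
[cite: Balaban1984PropagatorsI, (1.21) p.21] -/
theorem laplace_comp_eq_sum_plaq_add_diverg (X : PBond P j → ℝ) (μ : Fin P.d) (x : Site P j) :
    laplace 1 (fun y => X ⟨y, μ⟩) x =
      (∑ ν : Fin P.d, ((X ⟨x.unshift ν, ν⟩ + X ⟨x, μ⟩ - X ⟨(x.unshift ν).shift μ, ν⟩ - X ⟨x.unshift ν, μ⟩) -
          (X ⟨x, ν⟩ + X ⟨x.shift ν, μ⟩ - X ⟨x.shift μ, ν⟩ - X ⟨x, μ⟩))) +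
        (diverg 1 X (x.shift μ) - diverg 1 X x) := by
  have h0 := lop_pullback_eq_laplace x (fun y => X ⟨y, μ⟩) 0
  rw [transl_zero] at h0
  rw [← h0, lop_comp_eq_dvg_add_fdiff_dvg (fun w ν => X ⟨transl x w, ν⟩) μ 0, fdiff_apply, dvg_pullback_eq_diverg,
    dvg_pullback_eq_diverg, transl_add_unitVec, transl_zero, dvg_apply]
  congr 1
  refine Finset.sum_congr rfl fun ν _ => ?_
  rw [plaq_pullback_eq, plaq_pullback_eq, transl_sub_unitVec, transl_zero, shift_unshift']

/-- ★★ **MEAN-VALUE (SUP) BOUND ON THE TORUS FOR A FIELD WHOSE COMPONENT IS HARMONIC ON A BOX**, read through the periodic pullback along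
`transl x₀` (no period or injectivity hypothesis): `ℓ ≥ 1`, `ρ₀ ≥ 0`, `R := ρ₀ + ℓ + d(ℓ+2)`; if `(laplace 1 X_μ)(transl x₀ w) = 0` for all
`w ∈ Q_R(0)`, then for `z ∈ Q_{ρ₀}(0)`: `X⟨transl x₀ z, μ⟩² ≤ 2^d(1+56d)^d(ℓ+1)^{−d}·Σ_{w ∈ Q_R(0)} X⟨transl x₀ w, μ⟩²`. [folklore]
[cite: Giaquinta1984, Ch. III §2 (2.5) p.78] -/
theorem sq_pullback_le_of_harmonic (x₀ : Site P j) (X : PBond P j → ℝ) (μ : Fin P.d) {ℓ : ℕ} (hℓ : 1 ≤ ℓ) {ρ₀ : ℤ} (hρ₀ : 0 ≤ ρ₀)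
    (hh : ∀ w ∈ box (0 : Zd P.d) (ρ₀ + ℓ + P.d * ((ℓ : ℤ) + 2)), laplace 1 (fun y => X ⟨y, μ⟩) (transl x₀ w) = 0)
    {z : Zd P.d} (hz : z ∈ box (0 : Zd P.d) ρ₀) :
    X ⟨transl x₀ z, μ⟩ ^ 2 ≤ (2 : ℝ) ^ P.d * (1 + 56 * P.d) ^ P.d / ((ℓ : ℝ) + 1) ^ P.d *
      ∑ w ∈ box (0 : Zd P.d) (ρ₀ + ℓ + P.d * ((ℓ : ℤ) + 2)), X ⟨transl x₀ w, μ⟩ ^ 2 :=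
  sq_le_of_harmonic (κ := 0) le_rfl hℓ hρ₀ (fun w => X ⟨transl x₀ w, μ⟩)
    (fun w hw => (lop_pullback_eq_laplace x₀ (fun y => X ⟨y, μ⟩) w).trans (hh w hw)) hz

/-- ★★ **MEAN-VALUE (SUP) BOUND ON THE TORUS FOR CURL-FREE, DIVERGENCE-FREE BOND FIELDS** — the flat linear core of route R's interior
regularity input, in the ENLARGED-box shape: `ℓ ≥ 1`, `ρ₀ ≥ 0`, `R := ρ₀ + ℓ + d(ℓ+2)`; if `curl 1 X = 0` on every plaquette based at a site
`transl x₀ w`, `w ∈ Q_{R+1}(0)`, and `diverg 1 X (transl x₀ w) = 0` there, then for every `z ∈ Q_{ρ₀}(0)` and every direction `μ`: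
`X⟨transl x₀ z, μ⟩² ≤ 2^d(1+56d)^d(ℓ+1)^{−d} · Σ_{w ∈ Q_R(0)} X⟨transl x₀ w, μ⟩²` (no period∕injectivity hypothesis: the right side is the
pullback's box sum; for `2R+1 ≤ sitesPerDir j` it is the plain sum over the image).  Consumer's reading (d = 3, `ℓ = L^k`, `x₀ = embIter k c.src`):
sup over `B^k(c₋) ∪ B^k(c₊)` (`ρ₀ = (3L^k−1)/2`) against the mass on `transl x₀ '' Q_{8L^k}(0)`, constant `8·169³·(L^k+1)⁻³`. [folklore]
[cite: Giaquinta1984, Ch. III §2 (2.5) p.78; Balaban1984PropagatorsI, (1.21) p.21] -/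
theorem sq_le_of_curl_eq_zero_of_diverg_eq_zero (x₀ : Site P j) (X : PBond P j → ℝ) {ℓ : ℕ} (hℓ : 1 ≤ ℓ) {ρ₀ : ℤ} (hρ₀ : 0 ≤ ρ₀)
    (hC : ∀ w ∈ box (0 : Zd P.d) (ρ₀ + ℓ + P.d * ((ℓ : ℤ) + 2) + 1), ∀ (ν μ : Fin P.d) (hνμ : ν < μ),
      curl 1 X ⟨transl x₀ w, ν, μ, hνμ⟩ = 0)
    (hD : ∀ w ∈ box (0 : Zd P.d) (ρ₀ + ℓ + P.d * ((ℓ : ℤ) + 2) + 1), diverg 1 X (transl x₀ w) = 0)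
    {z : Zd P.d} (hz : z ∈ box (0 : Zd P.d) ρ₀) (μ : Fin P.d) :
    X ⟨transl x₀ z, μ⟩ ^ 2 ≤ (2 : ℝ) ^ P.d * (1 + 56 * P.d) ^ P.d / ((ℓ : ℝ) + 1) ^ P.d *
      ∑ w ∈ box (0 : Zd P.d) (ρ₀ + ℓ + P.d * ((ℓ : ℤ) + 2)), X ⟨transl x₀ w, μ⟩ ^ 2 := by
  refine sq_le_of_curlFree_divFree hℓ hρ₀ (fun w ν => X ⟨transl x₀ w, ν⟩) (fun w hw ν μ' => ?_) (fun w hw => ?_) hz μ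
  · rw [plaq_pullback_eq]
    exact plaq_eq_zero_of_curl_eq_zero X _ (hC w hw) ν μ'
  · rw [dvg_pullback_eq_diverg]
    exact hD w hw

end Torus

end Summit.QuantumFields.YangMills.Theorems.Prop7FlatInteriorMeanValue

end
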